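import Literature.MathematicalPhysics.QuantumLattice.ProductOperators
import Literature.MathematicalPhysics.QuantumLattice.FinDimSpectrum
import Mathlib.Combinatorics.SimpleGraph.Basic
import Mathlib.Logic.Relation
import HarnessLib

/-!
# The Peierls contour expansion for quantum (and classical) lattice systems
# (Fröhlich–Lieb 1978, §I.C, eqs. (1.25)–(1.30))

Topic `MathematicalPhysics/QuantumLattice`. Fröhlich–Lieb, *Phase transitions in anisotropic
lattice spin systems*, Comm. Math. Phys. **60** (1978) 233–267, §I.C "The Peierls argument"
(Selecta pp. 240–242 of the held copy): on a finite lattice `Λ`, at each site `j` two commuting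
positive operators `Pⱼ⁺`, `Pⱼ⁻` with `Pⱼ⁺ + Pⱼ⁻ = 1` (1.25) are given (single-site operators, so
operators at different sites commute). For two sites `m ≠ n`, expanding
`Pₘ⁺Pₙ⁻ = Pₘ⁺Pₙ⁻ ∏_{j ≠ m,n} (Pⱼ⁺ + Pⱼ⁻)` (1.26) over configurations `c : Λ → {+,-}` and
grouping the configurations according to the connected component `Λ_c` of `{c = +}` containing `m`
(1.27) gives, with the monotonicity `0 ≤ ∏_{j ∈ X} Pⱼ^{c(j)} ≤ ∏_{j ∈ Y} Pⱼ^{c(j)}` for `Y ⊆ X`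
(1.28), the **Peierls inequality** (1.29)–(1.30)
`⟨Pₘ⁺Pₙ⁻⟩ ≤ Σ_γ ⟨∏_{⟨i,j⟩ ∈ γ} Pᵢ⁺Pⱼ⁻⟩`,
the sum running over the "contours" `γ`: the families of nearest-neighbour pairs `⟨i, j⟩`, `i` in a
connected set `C ∋ m`, `n ∉ C`, `j ∉ C` (FL Definition 1), and `⟨·⟩` any state. This file proves
it in the tree's `ℓ²(Λ → Fin q)` picture, for an arbitrary finite simple graph `G` on the sites
(the nearest-neighbour relation) and an arbitrary positive linear functional:

* `productOp_update_add`, `productOp_piFinset_sum` — multilinearity of `⨂_x u_x` in each factor;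
  `productOp_posSemidef`, `productOp_sub_productOp_posSemidef` — positivity and the monotonicity
  (1.28) in the Loewner order (`0 ≤ u_x ≤ u'_x` for all `x` implies `⨂u ≤ ⨂u'`);
* `plusCluster G c m` — the component `Λ_c` of `m` in `{c = +}` (reachability through `+` sites);
  `IsPlusCluster`, `clusterFamily G m n` — the connected sets `C ∋ m`, `n ∉ C` (FL's `Λ_m(γ)`);
  `outerBoundary G C` (the sites `j ∉ C` adjacent to `C`, FL's `j_k`), `innerBoundary G C` (FL's
  `i_k`); `plusCluster_eq_iff` — `Λ_c = C` iff `c = +` on `C` and `c = -` on its outer boundary;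
* **`onSite_mul_onSite_eq_sum_clusterOp`** — the exact regrouped expansion (1.26)–(1.27):
  `Pₘ⁺Pₙ⁻ = Σ_{C ∈ clusterFamily} (∏_{i ∈ C} Pᵢ⁺)(∏_{j ∈ ∂⁺C ∪ {n}} Pⱼ⁻)` (an operator identity);
* **`peierls_contour_bound`** (FL (1.30)) — for every positive linear functional `ω`,
  `Re ω(Pₘ⁺Pₙ⁻) ≤ Σ_{C ∈ clusterFamily G m n} Re ω(∏_{i ∈ ∂⁻C} Pᵢ⁺ ∏_{j ∈ ∂⁺C} Pⱼ⁻)`, the summand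
  being the contour observable `∏_{⟨i,j⟩ ∈ γ(C)} Pᵢ⁺Pⱼ⁻` of the contour `γ(C) = ∂C`
  (`contourOp`; a site on several contour bonds carries its factor once, which is the same operator
  when the `P`'s are projections and is `≥` it in general); `peierls_contour_bound_gibbs` — the
  Gibbs state `⟨·⟩_{β,H}` of a Hermitian `H` is such a functional.

The hypotheses are weaker than printed (`P^± ≥ 0` with `P⁺ + P⁻ = 1` instead of orthogonal
projections; any graph). NOT here: the counting of contours of given length on `ℤ²` / the torus
(FL Thm. 1.1, `≤ 2(l-1)3^{2l-2}` contours of length `2l`) and the resulting bound (1.32); the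
chessboard estimate of the contour observables is `QuantumSpinChessboardEstimate.lean` /
`QuantumSpinBlockChessboardEstimate.lean`. No named facts; no sorries.

## References

* J. Fröhlich, E. H. Lieb, Comm. Math. Phys. **60** (1978) 233–267, §I.C eqs. (1.25)–(1.30),
  Definition 1, Thm. 1.1; reprinted in E. H. Lieb, *Statistical Mechanics (Selecta)*, Springer 2004.
  [FrohlichLieb1978]
* R. Peierls, Proc. Cambridge Philos. Soc. **32** (1936) 477–481; R. B. Griffiths, Phys. Rev.
  **136** (1964) A437 (the classical argument). [folklore]
-/

noncomputable section

open Matrix Finset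
open scoped ComplexOrder MatrixOrder BigOperators

namespace Literature.MathematicalPhysics.QuantumLattice

variable {Λ : Type*} [Fintype Λ] [DecidableEq Λ] {q : ℕ}

/-! ### Multilinearity and positivity of product operators -/

/-- **Multilinearity of `⨂` in one factor**: `⨂(u[x ↦ a + b]) = ⨂(u[x ↦ a]) + ⨂(u[x ↦ b])`.
[cite: FrohlichLieb1978, eq. (1.26)] -/
theorem productOp_update_add (u : Λ → Matrix (Fin q) (Fin q) ℂ) (x : Λ)
    (a b : Matrix (Fin q) (Fin q) ℂ) :
    productOp (Function.update u x (a + b)) =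
      productOp (Function.update u x a) + productOp (Function.update u x b) := by
  ext σ τ
  simp only [productOp_apply, Matrix.add_apply]
  rw [← Finset.mul_prod_erase univ _ (mem_univ x), ← Finset.mul_prod_erase univ _ (mem_univ x),
    ← Finset.mul_prod_erase univ
      (fun y => Function.update u x b y (σ y) (τ y)) (mem_univ x)]
  simp only [Function.update_self, Matrix.add_apply]
  have h : ∀ c : Matrix (Fin q) (Fin q) ℂ,
      ∏ y ∈ univ.erase x, Function.update u x c y (σ y) (τ y) =
        ∏ y ∈ univ.erase x, u y (σ y) (τ y) := fun c =>
    prod_congr rfl fun y hy => by rw [Function.update_of_ne (ne_of_mem_erase hy)]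
  rw [h, h, h, add_mul]

/-- **Multilinearity of `⨂`, expanded**: `⨂_j (Σ_{s ∈ S j} v_j(s)) = Σ_{c ∈ Π_j S j} ⨂_j v_j(c_j)`
(the expansion of FL (1.26) over configurations `c`).
[cite: FrohlichLieb1978, eqs. (1.26)–(1.27)] -/
theorem productOp_piFinset_sum {κ : Type*} [DecidableEq κ] (S : Λ → Finset κ)
    (v : Λ → κ → Matrix (Fin q) (Fin q) ℂ) :
    productOp (fun j => ∑ s ∈ S j, v j s) =
      ∑ c ∈ Fintype.piFinset S, productOp (fun j => v j (c j)) := by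
  ext σ τ
  simp only [productOp_apply, Matrix.sum_apply]
  rw [Finset.prod_univ_sum]

/-- A product of positive single-site operators is positive: `u_x = b_xᴴ b_x` for all `x` gives
`⨂u = (⨂b)ᴴ(⨂b)`. [cite: FrohlichLieb1978, eq. (1.28)] -/
theorem productOp_posSemidef {u : Λ → Matrix (Fin q) (Fin q) ℂ} (hu : ∀ x, (u x).PosSemidef) :
    (productOp u).PosSemidef := by
  choose b hb using fun x => CStarAlgebra.nonneg_iff_eq_star_mul_self.mp (hu x).nonneg
  have h : productOp u = (productOp b)ᴴ * productOp b := by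
    rw [productOp_conjTranspose, productOp_mul]
    congr 1
    funext x
    rw [hb x, star_eq_conjTranspose]
  rw [h]
  exact posSemidef_conjTranspose_mul_self _

/-- **Monotonicity (FL (1.28))**: if `0 ≤ u_x` and `0 ≤ u'_x - u_x` for every site, then
`⨂u ≤ ⨂u'` (so dropping factors `0 ≤ P ≤ 1`, i.e. replacing them by `1`, increases the product).
Proof: replace the factors one at a time; each step adds `⨂(…, u'_x - u_x, …) ≥ 0`.
[cite: FrohlichLieb1978, eq. (1.28)] -/
theorem productOp_sub_productOp_posSemidef {u u' : Λ → Matrix (Fin q) (Fin q) ℂ}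
    (hu : ∀ x, (u x).PosSemidef) (hd : ∀ x, (u' x - u x).PosSemidef) :
    (productOp u' - productOp u).PosSemidef := by
  have hu' : ∀ x, (u' x).PosSemidef := fun x => by
    have := (hd x).add (hu x); rwa [sub_add_cancel] at this
  -- replace the factors on a growing set `s`
  suffices h : ∀ s : Finset Λ,
      (productOp (fun x => if x ∈ s then u' x else u x) - productOp u).PosSemidef by
    have := h univ
    simpa only [mem_univ, if_true] using this
  intro s
  induction s using Finset.induction_on with
  | empty => simpa using PosSemidef.zero
  | @insert a s ha ih =>
    have hsplit : (productOp fun x => if x ∈ insert a s then u' x else u x) -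
        productOp (fun x => if x ∈ s then u' x else u x) =
        productOp (Function.update (fun x => if x ∈ s then u' x else u x) a (u' a - u a)) := by
      have h1 : (fun x => if x ∈ insert a s then u' x else u x) =
          Function.update (fun x => if x ∈ s then u' x else u x) a ((u' a - u a) + u a) := by
        funext x
        by_cases hx : x = a
        · subst hx; simp
        · rw [Function.update_of_ne hx]; simp [hx]
      have h2 : (fun x => if x ∈ s then u' x else u x) =
          Function.update (fun x => if x ∈ s then u' x else u x) a (u a) := by
        funext x
        by_cases hx : x = a
        · subst hx; simp [ha]
        · rw [Function.update_of_ne hx]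
      rw [h1, productOp_update_add, ← h2, add_sub_cancel_right]
    have hstep : (productOp (Function.update (fun x => if x ∈ s then u' x else u x) a
        (u' a - u a))).PosSemidef := by
      refine productOp_posSemidef fun x => ?_
      by_cases hx : x = a
      · subst hx; simpa using hd x
      · rw [Function.update_of_ne hx]
        split_ifs
        · exact hu' x
        · exact hu x
    have := hstep.add ih
    rwa [← hsplit, sub_add_sub_cancel] at this

/-! ### Clusters of `+` sites and contours -/

section Clusters

variable (G : SimpleGraph Λ)

/-- One step inside the `+` sites of a configuration: `i ~ j` and `c(j) = +`.
[cite: FrohlichLieb1978, §I.C Definition 1] -/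
def plusStep (c : Λ → Bool) (i j : Λ) : Prop := G.Adj i j ∧ c j = true

/-- **The `+` cluster of `m`** (FL's `Λ_c`): the sites reachable from `m` through nearest-neighbour
steps inside `{c = +}`. [cite: FrohlichLieb1978, §I.C Definition 1] -/
def plusCluster (c : Λ → Bool) (m : Λ) : Finset Λ :=
  open Classical in univ.filter fun j => Relation.ReflTransGen (plusStep G c) m j

/-- **Connected sets through `m`** (FL's `Λ_m(γ)`): `m ∈ C` and every site of `C` is reached from
`m` by nearest-neighbour steps inside `C`. [cite: FrohlichLieb1978, §I.C Definition 1] -/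
def IsPlusCluster (m : Λ) (C : Finset Λ) : Prop :=
  m ∈ C ∧ ∀ j ∈ C, Relation.ReflTransGen (fun i j => G.Adj i j ∧ j ∈ C) m j

/-- **The contour index set**: connected sets `C ∋ m` with `n ∉ C`; their boundaries are FL's
contours `γ` separating `m` from `n`. [cite: FrohlichLieb1978, §I.C Definition 1] -/
def clusterFamily (m n : Λ) : Finset (Finset Λ) :=
  open Classical in univ.filter fun C => IsPlusCluster G m C ∧ n ∉ C

/-- The outer vertex boundary `∂⁺C`: sites outside `C` with a neighbour in `C` (the `j_k` of FL's
contour `{⟨i_k, j_k⟩}`). [cite: FrohlichLieb1978, §I.C Definition 1] -/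
def outerBoundary (C : Finset Λ) : Finset Λ :=
  open Classical in univ.filter fun j => j ∉ C ∧ ∃ i ∈ C, G.Adj i j

/-- The inner vertex boundary `∂⁻C`: sites of `C` with a neighbour outside `C` (the `i_k`).
[cite: FrohlichLieb1978, §I.C Definition 1] -/
def innerBoundary (C : Finset Λ) : Finset Λ :=
  open Classical in univ.filter fun i => i ∈ C ∧ ∃ j, j ∉ C ∧ G.Adj i j

variable {G}

omit [DecidableEq Λ] in
/-- Membership in the `+` cluster. [cite: FrohlichLieb1978, §I.C Definition 1] -/
theorem mem_plusCluster {c : Λ → Bool} {m j : Λ} :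
    j ∈ plusCluster G c m ↔ Relation.ReflTransGen (plusStep G c) m j := by
  classical
  simp [plusCluster]

/-- Membership in the outer boundary. [cite: FrohlichLieb1978, §I.C Definition 1] -/
theorem mem_outerBoundary {C : Finset Λ} {j : Λ} :
    j ∈ outerBoundary G C ↔ j ∉ C ∧ ∃ i ∈ C, G.Adj i j := by
  classical
  simp [outerBoundary]

/-- Membership in the inner boundary. [cite: FrohlichLieb1978, §I.C Definition 1] -/
theorem mem_innerBoundary {C : Finset Λ} {i : Λ} :
    i ∈ innerBoundary G C ↔ i ∈ C ∧ ∃ j, j ∉ C ∧ G.Adj i j := by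
  classical
  simp [innerBoundary]

/-- Membership in the contour index set. [cite: FrohlichLieb1978, §I.C Definition 1] -/
theorem mem_clusterFamily {m n : Λ} {C : Finset Λ} :
    C ∈ clusterFamily G m n ↔ IsPlusCluster G m C ∧ n ∉ C := by
  classical
  simp [clusterFamily]

omit [DecidableEq Λ] in
/-- `m` is in its own `+` cluster. [cite: FrohlichLieb1978, §I.C Definition 1] -/
theorem self_mem_plusCluster (c : Λ → Bool) (m : Λ) : m ∈ plusCluster G c m :=
  mem_plusCluster.2 Relation.ReflTransGen.refl

omit [DecidableEq Λ] in
/-- The `+` cluster of a `+` site consists of `+` sites.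
[cite: FrohlichLieb1978, §I.C Definition 1] -/
theorem eq_true_of_mem_plusCluster {c : Λ → Bool} {m j : Λ} (hm : c m = true)
    (hj : j ∈ plusCluster G c m) : c j = true := by
  rw [mem_plusCluster] at hj
  induction hj with
  | refl => exact hm
  | tail _ h _ => exact h.2

omit [DecidableEq Λ] in
/-- The `+` cluster is closed under steps to `+` neighbours.
[cite: FrohlichLieb1978, §I.C Definition 1] -/
theorem mem_plusCluster_of_adj {c : Λ → Bool} {m i j : Λ} (hi : i ∈ plusCluster G c m)
    (hij : G.Adj i j) (hj : c j = true) : j ∈ plusCluster G c m :=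
  mem_plusCluster.2 ((mem_plusCluster.1 hi).tail ⟨hij, hj⟩)

omit [DecidableEq Λ] in
/-- The `+` cluster of a `+` site is a connected set through it (FL: "there exists a connected set
`Λ_c ∋ m`, `c(i) = +` for all `i ∈ Λ_c`"). [cite: FrohlichLieb1978, §I.C Definition 1] -/
theorem isPlusCluster_plusCluster (c : Λ → Bool) (m : Λ) :
    IsPlusCluster G m (plusCluster G c m) := by
  refine ⟨self_mem_plusCluster c m, fun j hj => ?_⟩
  rw [mem_plusCluster] at hj
  induction hj with
  | refl => exact Relation.ReflTransGen.refl
  | @tail i k hmi hik ih =>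
    exact ih.tail ⟨hik.1, mem_plusCluster.2 (hmi.tail hik)⟩

/-- **Characterisation of the fibre** `{c : Λ_c = C}`: for a connected set `C ∋ m`, the `+` cluster
of `m` is `C` iff `c = +` on `C` and `c = -` on the outer boundary of `C` (the configurations with
`γ(C) ∈ Γ(c)` and `Λ_c = Λ_m(γ)`, FL (1.27)/(1.29)).
[cite: FrohlichLieb1978, eqs. (1.27), (1.29)] -/
theorem plusCluster_eq_iff {c : Λ → Bool} {m : Λ} {C : Finset Λ} (hC : IsPlusCluster G m C)
    (hm : c m = true) :
    plusCluster G c m = C ↔ (∀ j ∈ C, c j = true) ∧ ∀ j ∈ outerBoundary G C, c j = false := by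
  constructor
  · rintro rfl
    exact ⟨fun j hj => eq_true_of_mem_plusCluster hm hj, fun j hj => by
      obtain ⟨hjC, i, hiC, hij⟩ := mem_outerBoundary.1 hj
      by_contra h
      rw [Bool.not_eq_false] at h
      exact hjC (mem_plusCluster_of_adj hiC hij h)⟩
  · rintro ⟨hplus, hminus⟩
    ext j
    constructor
    · intro hj
      rw [mem_plusCluster] at hj
      induction hj with
      | refl => exact hC.1
      | @tail i k _ hik ih =>
        by_contra hk
        have h0 := hminus k (mem_outerBoundary.2 ⟨hk, i, ih, hik.1⟩)
        rw [hik.2] at h0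
        exact Bool.noConfusion h0
    · intro hj
      have key : ∀ k, Relation.ReflTransGen (fun i j => G.Adj i j ∧ j ∈ C) m k →
          Relation.ReflTransGen (plusStep G c) m k := by
        intro k hk
        induction hk with
        | refl => exact Relation.ReflTransGen.refl
        | tail _ h ih => exact ih.tail ⟨h.1, hplus _ h.2⟩
      exact mem_plusCluster.2 (key j (hC.2 j hj))

end Clusters

/-! ### The expansion (1.26)–(1.27) and the Peierls inequality (1.30) -/

section Expansion

variable (G : SimpleGraph Λ)

/-- The observable of a configuration `c : Λ → {+,-}`: `Q_c = ⨂_j P_j^{c(j)}` (the summands of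
FL (1.27)). [cite: FrohlichLieb1978, eq. (1.27)] -/
def configOp (Pp Pm : Matrix (Fin q) (Fin q) ℂ) (c : Λ → Bool) : Op Λ q :=
  productOp fun j => if c j then Pp else Pm

/-- The configurations of FL Definition 1: `c(m) = +`, `c(n) = -`.
[cite: FrohlichLieb1978, §I.C Definition 1] -/
def validConfigs (m n : Λ) : Finset (Λ → Bool) :=
  Fintype.piFinset fun j => if j = m then {true} else if j = n then {false} else univ

/-- Membership in `validConfigs`. [cite: FrohlichLieb1978, §I.C Definition 1] -/
theorem mem_validConfigs {m n : Λ} (hmn : m ≠ n) {c : Λ → Bool} :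
    c ∈ validConfigs m n ↔ c m = true ∧ c n = false := by
  simp only [validConfigs, Fintype.mem_piFinset]
  constructor
  · intro h
    refine ⟨?_, ?_⟩
    · have hm := h m
      rw [if_pos rfl, mem_singleton] at hm
      exact hm
    · have hn := h n
      rw [if_neg hmn.symm, if_pos rfl, mem_singleton] at hn
      exact hn
  · rintro ⟨hm, hn⟩ j
    by_cases hjm : j = m
    · subst hjm; rw [if_pos rfl, mem_singleton]; exact hm
    · rw [if_neg hjm]
      by_cases hjn : j = n
      · subst hjn; rw [if_pos rfl, mem_singleton]; exact hn
      · rw [if_neg hjn]; exact mem_univ _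

/-- **FL (1.26)–(1.27), first line**: `Pₘ⁺Pₙ⁻ = Pₘ⁺Pₙ⁻ ∏_{j ≠ m,n}(Pⱼ⁺ + Pⱼ⁻) = Σ_c ⨂_j Pⱼ^{c(j)}`,
the sum over the configurations with `c(m) = +`, `c(n) = -`.
[cite: FrohlichLieb1978, eqs. (1.26)–(1.27)] -/
theorem onSite_mul_onSite_eq_sum_configOp {Pp Pm : Matrix (Fin q) (Fin q) ℂ} (hsum : Pp + Pm = 1)
    {m n : Λ} (hmn : m ≠ n) :
    (onSite m Pp * onSite n Pm : Op Λ q) = ∑ c ∈ validConfigs m n, configOp Pp Pm c := by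
  rw [onSite_mul_onSite_eq_productOp hmn]
  have h : Function.update (Function.update (fun _ => (1 : Matrix (Fin q) (Fin q) ℂ)) n Pm) m Pp =
      fun j => ∑ s ∈ (if j = m then {true} else if j = n then {false} else (univ : Finset Bool)),
        (if s then Pp else Pm) := by
    funext j
    by_cases hjm : j = m
    · subst hjm
      rw [Function.update_self, if_pos rfl, sum_singleton, if_pos rfl]
    · rw [Function.update_of_ne hjm, if_neg hjm]
      by_cases hjn : j = n
      · subst hjn
        rw [Function.update_self, if_pos rfl, sum_singleton]
        rfl
      · rw [Function.update_of_ne hjn, if_neg hjn, Fintype.sum_bool, ← hsum]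
        rfl
  rw [h, productOp_piFinset_sum]
  rfl

/-- The `+` cluster of `m` of a valid configuration is a connected set `∋ m`, `∌ n`.
[cite: FrohlichLieb1978, §I.C Definition 1] -/
theorem plusCluster_mem_clusterFamily {m n : Λ} (hmn : m ≠ n) {c : Λ → Bool}
    (hc : c ∈ validConfigs m n) : plusCluster G c m ∈ clusterFamily G m n := by
  obtain ⟨hm, hn⟩ := (mem_validConfigs hmn).1 hc
  refine mem_clusterFamily.2 ⟨isPlusCluster_plusCluster c m, fun h => ?_⟩
  have h' := eq_true_of_mem_plusCluster hm h
  rw [hn] at h'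
  exact Bool.noConfusion h'

/-- **The cluster observable** `(∏_{i ∈ C} Pᵢ⁺)(∏_{j ∈ ∂⁺C ∪ {n}} Pⱼ⁻)`: the sum of `Q_c` over the
configurations whose `+` cluster of `m` is `C` (FL (1.29), first equality: `Pₘ⁺Pₙ⁻ ∏_{γ} Pᵢ⁺Pⱼ⁻`
times the free sites summed out, with the interior factors kept).
[cite: FrohlichLieb1978, eq. (1.29)] -/
def clusterOp (Pp Pm : Matrix (Fin q) (Fin q) ℂ) (n : Λ) (C : Finset Λ) : Op Λ q :=
  productOp fun j => if j ∈ C then Pp else if j ∈ outerBoundary G C ∨ j = n then Pm else 1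

/-- **The contour observable** `∏_{⟨i,j⟩ ∈ γ(C)} Pᵢ⁺Pⱼ⁻ = (∏_{i ∈ ∂⁻C} Pᵢ⁺)(∏_{j ∈ ∂⁺C} Pⱼ⁻)`
(FL (1.30); a site on several contour bonds carries its factor once).
[cite: FrohlichLieb1978, eq. (1.30)] -/
def contourOp (Pp Pm : Matrix (Fin q) (Fin q) ℂ) (C : Finset Λ) : Op Λ q :=
  productOp fun j => if j ∈ innerBoundary G C then Pp else if j ∈ outerBoundary G C then Pm else 1

/-- **Summing the fibre** (FL (1.29)): `Σ_{c : Λ_c = C} Q_c = (∏_{C} P⁺)(∏_{∂⁺C ∪ {n}} P⁻)`, the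
remaining sites carrying `P⁺ + P⁻ = 1`. [cite: FrohlichLieb1978, eq. (1.29)] -/
theorem sum_configOp_fiber {Pp Pm : Matrix (Fin q) (Fin q) ℂ} (hsum : Pp + Pm = 1) {m n : Λ}
    (hmn : m ≠ n) {C : Finset Λ} (hC : C ∈ clusterFamily G m n) :
    ∑ c ∈ (validConfigs m n).filter (fun c => plusCluster G c m = C), configOp Pp Pm c =
      clusterOp G Pp Pm n C := by
  classical
  obtain ⟨hCl, hnC⟩ := mem_clusterFamily.1 hC
  -- the fibre is a box of configurations
  set T : Λ → Finset Bool := fun j =>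
    if j ∈ C then {true} else if j ∈ outerBoundary G C ∨ j = n then {false} else univ with hT
  have hfib : (validConfigs m n).filter (fun c => plusCluster G c m = C) = Fintype.piFinset T := by
    ext c
    rw [mem_filter, mem_validConfigs hmn, Fintype.mem_piFinset]
    constructor
    · rintro ⟨⟨hm, hn⟩, hcl⟩ j
      obtain ⟨hplus, hminus⟩ := (plusCluster_eq_iff hCl hm).1 hcl
      simp only [hT]
      by_cases hjC : j ∈ C
      · rw [if_pos hjC, mem_singleton]; exact hplus j hjC
      · rw [if_neg hjC]
        by_cases hj' : j ∈ outerBoundary G C ∨ j = n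
        · rw [if_pos hj', mem_singleton]
          rcases hj' with h | h
          · exact hminus j h
          · rw [h]; exact hn
        · rw [if_neg hj']; exact mem_univ _
    · intro h
      have hplus : ∀ j ∈ C, c j = true := fun j hj => by
        have hj' := h j
        simp only [hT, if_pos hj, mem_singleton] at hj'
        exact hj'
      have hminus : ∀ j ∈ outerBoundary G C, c j = false := fun j hj => by
        have hjC : j ∉ C := (mem_outerBoundary.1 hj).1
        have hj' := h j
        simp only [hT, if_neg hjC, if_pos (Or.inl hj : j ∈ outerBoundary G C ∨ j = n),
          mem_singleton] at hj'
        exact hj'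
      have hm : c m = true := hplus m hCl.1
      have hn : c n = false := by
        have hTn : T n = {false} := by
          show (if n ∈ C then {true} else if n ∈ outerBoundary G C ∨ n = n then {false}
            else univ) = ({false} : Finset Bool)
          rw [if_neg hnC, if_pos (Or.inr rfl)]
        have hj' := h n
        rw [hTn, mem_singleton] at hj'
        exact hj'
      exact ⟨⟨hm, hn⟩, (plusCluster_eq_iff hCl hm).2 ⟨hplus, hminus⟩⟩
  rw [hfib]
  have hexp := productOp_piFinset_sum (Λ := Λ) T (fun _ s => if s then Pp else Pm)
  simp only [configOp]
  rw [← hexp, clusterOp]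
  congr 1
  funext j
  simp only [hT]
  by_cases hjC : j ∈ C
  · rw [if_pos hjC, if_pos hjC, sum_singleton, if_pos rfl]
  · rw [if_neg hjC, if_neg hjC]
    by_cases hj' : j ∈ outerBoundary G C ∨ j = n
    · rw [if_pos hj', if_pos hj', sum_singleton]
      rfl
    · rw [if_neg hj', if_neg hj', Fintype.sum_bool, ← hsum]
      rfl

/-- **The regrouped expansion (FL (1.26)–(1.27), an operator identity)**: for single-site
`P⁺ + P⁻ = 1` and sites `m ≠ n` of a finite graph,
`Pₘ⁺Pₙ⁻ = Σ_{C connected ∋ m, n ∉ C} (∏_{i ∈ C} Pᵢ⁺)(∏_{j ∈ ∂⁺C ∪ {n}} Pⱼ⁻)`.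
[cite: FrohlichLieb1978, eqs. (1.26)–(1.27), (1.29)] -/
theorem onSite_mul_onSite_eq_sum_clusterOp {Pp Pm : Matrix (Fin q) (Fin q) ℂ} (hsum : Pp + Pm = 1)
    {m n : Λ} (hmn : m ≠ n) :
    (onSite m Pp * onSite n Pm : Op Λ q) = ∑ C ∈ clusterFamily G m n, clusterOp G Pp Pm n C := by
  classical
  rw [onSite_mul_onSite_eq_sum_configOp hsum hmn,
    ← Finset.sum_fiberwise_of_maps_to (g := fun c => plusCluster G c m)
      (fun c hc => plusCluster_mem_clusterFamily G hmn hc)]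
  exact sum_congr rfl fun C hC => sum_configOp_fiber G hsum hmn hC

/-- **FL (1.28)–(1.29), last step**: dropping the interior factors `Pᵢ⁺`, `i ∈ C ∖ ∂⁻C`, and the
factor `Pₙ⁻` when `n ∉ ∂⁺C` (all `0 ≤ P ≤ 1`) increases the cluster observable to the contour
observable: `(∏_C P⁺)(∏_{∂⁺C ∪ {n}} P⁻) ≤ ∏_{⟨i,j⟩ ∈ γ(C)} Pᵢ⁺Pⱼ⁻` in the operator order.
[cite: FrohlichLieb1978, eqs. (1.28)–(1.29)] -/
theorem contourOp_sub_clusterOp_posSemidef {Pp Pm : Matrix (Fin q) (Fin q) ℂ}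
    (hPp : Pp.PosSemidef) (hPm : Pm.PosSemidef) (hsum : Pp + Pm = 1) (n : Λ) (C : Finset Λ) :
    (contourOp G Pp Pm C - clusterOp G Pp Pm n C).PosSemidef := by
  have h1p : (1 : Matrix (Fin q) (Fin q) ℂ) - Pp = Pm := by rw [← hsum]; abel
  have h1m : (1 : Matrix (Fin q) (Fin q) ℂ) - Pm = Pp := by rw [← hsum]; abel
  refine productOp_sub_productOp_posSemidef (fun j => ?_) (fun j => ?_)
  · split_ifs
    exacts [hPp, hPm, PosSemidef.one]
  · by_cases hjC : j ∈ C
    · have hjo : j ∉ outerBoundary G C := fun h => (mem_outerBoundary.1 h).1 hjC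
      rw [if_pos hjC]
      by_cases hji : j ∈ innerBoundary G C
      · rw [if_pos hji, sub_self]; exact PosSemidef.zero
      · rw [if_neg hji, if_neg hjo, h1p]; exact hPm
    · have hji : j ∉ innerBoundary G C := fun h => hjC (mem_innerBoundary.1 h).1
      rw [if_neg hjC, if_neg hji]
      by_cases hjo : j ∈ outerBoundary G C
      · rw [if_pos (Or.inl hjo), if_pos hjo, sub_self]; exact PosSemidef.zero
      · rw [if_neg hjo]
        by_cases hjn : j = n
        · rw [if_pos (Or.inr hjn), h1m]; exact hPp
        · rw [if_neg (not_or.2 ⟨hjo, hjn⟩), sub_self]; exact PosSemidef.zero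

/-- **The Peierls inequality (Fröhlich–Lieb 1978, eq. (1.30))**: for single-site `P^± ≥ 0` with
`P⁺ + P⁻ = 1`, sites `m ≠ n` of a finite graph and every positive linear functional `ω` on the
observables,
`Re ω(Pₘ⁺Pₙ⁻) ≤ Σ_{C connected ∋ m, n ∉ C} Re ω(∏_{⟨i,j⟩ ∈ γ(C)} Pᵢ⁺Pⱼ⁻)` — "`⟨Pₘ⁺Pₙ⁻⟩ ≤ Σ_γ
⟨∏_{⟨i,j⟩∈γ} Pᵢ⁺Pⱼ⁻⟩`", the contours being the boundaries `γ(C)` of the connected sets `C`.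
[cite: FrohlichLieb1978, eq. (1.30)] -/
theorem peierls_contour_bound {Pp Pm : Matrix (Fin q) (Fin q) ℂ} (hPp : Pp.PosSemidef)
    (hPm : Pm.PosSemidef) (hsum : Pp + Pm = 1) {m n : Λ} (hmn : m ≠ n) (ω : Op Λ q →ₗ[ℂ] ℂ)
    (hω : ∀ X : Op Λ q, X.PosSemidef → 0 ≤ (ω X).re) :
    (ω (onSite m Pp * onSite n Pm)).re ≤
      ∑ C ∈ clusterFamily G m n, (ω (contourOp G Pp Pm C)).re := by
  rw [onSite_mul_onSite_eq_sum_clusterOp G hsum hmn, map_sum, Complex.re_sum]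
  refine sum_le_sum fun C _ => ?_
  have h := hω _ (contourOp_sub_clusterOp_posSemidef G hPp hPm hsum n C)
  rw [map_sub, Complex.sub_re] at h
  linarith

/-- **The Peierls inequality for the Gibbs state** `⟨·⟩_{β,H} = Tr(· e^{-βH})/Tr e^{-βH}` of a
Hermitian Hamiltonian (a positive linear functional):
`Re⟨Pₘ⁺Pₙ⁻⟩_{β,H} ≤ Σ_{C} Re⟨∏_{⟨i,j⟩ ∈ γ(C)} Pᵢ⁺Pⱼ⁻⟩_{β,H}`.
[cite: FrohlichLieb1978, eq. (1.30)] -/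
theorem peierls_contour_bound_gibbs {Pp Pm : Matrix (Fin q) (Fin q) ℂ} (hPp : Pp.PosSemidef)
    (hPm : Pm.PosSemidef) (hsum : Pp + Pm = 1) {m n : Λ} (hmn : m ≠ n) (β : ℝ) {H : Op Λ q}
    (hH : H.IsHermitian) :
    (Matrix.gibbsState β H (onSite m Pp * onSite n Pm)).re ≤
      ∑ C ∈ clusterFamily G m n, (Matrix.gibbsState β H (contourOp G Pp Pm C)).re :=
  peierls_contour_bound G hPp hPm hsum hmn (Matrix.gibbsState β H)
    fun _ hX => (Complex.nonneg_iff.1 (Matrix.gibbsState_nonneg_of_posSemidef β hH hX)).1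

end Expansion

end Literature.MathematicalPhysics.QuantumLattice

end
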